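import Summits.Ventures.HodgeRepro2.T5U11Unimodular

/-!
# The centre of `U(1,1)` is the scalar circle `U(1)·1`

`Z_j = {λ·1 : |λ| = 1}`: an element of `U(1,1)` commuting with `J = diag(1, -1)` is diagonal, and a
diagonal element commuting with the hyperbolic element `!![cosh 1, sinh 1; sinh 1, cosh 1]` is
scalar; conversely scalars are central (`T5U11Unimodular.scalarUnit_mem_center`).  This identifies
the centre `Z_j` of `H_j = U(1,1)` in the support map's «`vol(Z_j)`» (N4.3 / P3) with the circle
group of scalar matrices.

Blind lane: Mathlib + own prefix only; no sorry; axioms ⊆ {propext, Classical.choice, Quot.sound}.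
-/

namespace Summit.Ventures.HodgeRepro2.T5U11Center

open MeasureTheory Topology T5CayleySU11 T5UnitaryBound T5U11Unimodular
open Matrix hiding J

/-- `J = diag(1, -1)` as an element of `GL₂(ℂ)` (`J² = 1`). -/
def JUnit : GL (Fin 2) ℂ := ⟨J, J, J_mul_J, J_mul_J⟩

/-- The matrix of `JUnit`. -/
@[simp] lemma coe_JUnit : ((JUnit : GL (Fin 2) ℂ) : Matrix (Fin 2) (Fin 2) ℂ) = J := rfl

/-- `J ∈ U(1,1)`. -/
theorem JUnit_mem : JUnit ∈ U11 := by
  rw [mem_U11_iff, coe_JUnit, MemU11]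
  have hJ : Jᴴ = J := by
    ext i j
    fin_cases i <;> fin_cases j <;> simp [J]
  rw [hJ, J_mul_J, Matrix.one_mul]

/-- `hyperbolicC t * hyperbolicC (-t) = 1` (`cosh² - sinh² = 1`). -/
lemma hyperbolicC_mul_neg (t : ℝ) : hyperbolicC t * hyperbolicC (-t) = 1 := by
  have h := Complex.cosh_sq_sub_sinh_sq (t : ℂ)
  ext i j
  fin_cases i <;> fin_cases j <;>
    simp [hyperbolicC, Matrix.mul_apply, Fin.sum_univ_two, Real.cosh_neg, Real.sinh_neg]
  · linear_combination h
  · ring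
  · ring
  · linear_combination h

/-- `hyperbolicC (-t) * hyperbolicC t = 1`. -/
lemma hyperbolicC_neg_mul (t : ℝ) : hyperbolicC (-t) * hyperbolicC t = 1 := by
  have h := hyperbolicC_mul_neg (-t)
  rwa [neg_neg] at h

/-- The hyperbolic element `!![cosh t, sinh t; sinh t, cosh t]` as an element of `GL₂(ℂ)`
(inverse `!![cosh t, -sinh t; -sinh t, cosh t]`). -/
noncomputable def hypUnit (t : ℝ) : GL (Fin 2) ℂ :=
  ⟨hyperbolicC t, hyperbolicC (-t), hyperbolicC_mul_neg t, hyperbolicC_neg_mul t⟩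

/-- The matrix of `hypUnit t`. -/
@[simp] lemma coe_hypUnit (t : ℝ) :
    ((hypUnit t : GL (Fin 2) ℂ) : Matrix (Fin 2) (Fin 2) ℂ) = hyperbolicC t := rfl

/-- The hyperbolic elements lie in `U(1,1)` (they are Cayley conjugates of `diag(eᵗ, e⁻ᵗ)`). -/
theorem hypUnit_mem (t : ℝ) : hypUnit t ∈ U11 := by
  rw [mem_U11_iff, coe_hypUnit, ← cayleyConj_cartanReal]
  have h : cartanReal t = !![((Real.exp t : ℝ) : ℂ), ((0 : ℝ) : ℂ); ((0 : ℝ) : ℂ),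
      ((Real.exp (-t) : ℝ) : ℂ)] := by
    simp [cartanReal]
  rw [h]
  apply memU11_cayleyConj_real
  simp [Real.exp_neg, Real.exp_ne_zero]

/-- An element of `U(1,1)` commuting with `J` is diagonal. -/
theorem offDiag_eq_zero_of_commute_J {z : GL (Fin 2) ℂ} (h : z * JUnit = JUnit * z) :
    (z : Matrix (Fin 2) (Fin 2) ℂ) 0 1 = 0 ∧ (z : Matrix (Fin 2) (Fin 2) ℂ) 1 0 = 0 := by
  have h' : (z : Matrix (Fin 2) (Fin 2) ℂ) * J = J * (z : Matrix (Fin 2) (Fin 2) ℂ) := by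
    have := congr_arg Units.val h
    simpa only [Units.val_mul, coe_JUnit] using this
  have h01 := congr_fun (congr_fun h' 0) 1
  have h10 := congr_fun (congr_fun h' 1) 0
  simp [Matrix.mul_apply, Fin.sum_univ_two, J] at h01 h10
  constructor
  · linear_combination (-1 / 2 : ℂ) * h01
  · linear_combination (1 / 2 : ℂ) * h10

/-- An element with vanishing `(0,1)` entry commuting with `hypUnit 1` has equal diagonal entries. -/
theorem diag_eq_of_commute_hyp {z : GL (Fin 2) ℂ} (h : z * hypUnit 1 = hypUnit 1 * z)
    (h01 : (z : Matrix (Fin 2) (Fin 2) ℂ) 0 1 = 0) :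
    (z : Matrix (Fin 2) (Fin 2) ℂ) 1 1 = (z : Matrix (Fin 2) (Fin 2) ℂ) 0 0 := by
  have h' : (z : Matrix (Fin 2) (Fin 2) ℂ) * hyperbolicC 1 =
      hyperbolicC 1 * (z : Matrix (Fin 2) (Fin 2) ℂ) := by
    have := congr_arg Units.val h
    simpa only [Units.val_mul, coe_hypUnit] using this
  have e := congr_fun (congr_fun h' 0) 1
  simp [Matrix.mul_apply, Fin.sum_univ_two, hyperbolicC, h01] at e
  have hs : Complex.sinh (1 : ℂ) ≠ 0 := by
    rw [← Complex.ofReal_one, ← Complex.ofReal_sinh]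
    exact_mod_cast (Real.sinh_pos_iff.mpr one_pos).ne'
  exact mul_right_cancel₀ hs ((mul_comm _ _).trans e.symm)

/-- **The centre of `U(1,1)` is the scalar circle**: `z ∈ Z(U(1,1))` iff `z = λ·1` with `|λ| = 1`. -/
theorem mem_center_iff (z : U11) :
    z ∈ Subgroup.center U11 ↔
      ∃ lam : ℂ, Complex.normSq lam = 1 ∧
        ((z : GL (Fin 2) ℂ) : Matrix (Fin 2) (Fin 2) ℂ) = lam • 1 := by
  constructor
  · intro hz
    rw [Subgroup.mem_center_iff] at hz
    have hJ : (z : GL (Fin 2) ℂ) * JUnit = JUnit * (z : GL (Fin 2) ℂ) :=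
      congr_arg Subtype.val (hz ⟨JUnit, JUnit_mem⟩).symm
    have hH : (z : GL (Fin 2) ℂ) * hypUnit 1 = hypUnit 1 * (z : GL (Fin 2) ℂ) :=
      congr_arg Subtype.val (hz ⟨hypUnit 1, hypUnit_mem 1⟩).symm
    obtain ⟨h01, h10⟩ := offDiag_eq_zero_of_commute_J hJ
    have h11 := diag_eq_of_commute_hyp hH h01
    set lam : ℂ := ((z : GL (Fin 2) ℂ) : Matrix (Fin 2) (Fin 2) ℂ) 0 0 with hlam
    have hz' : ((z : GL (Fin 2) ℂ) : Matrix (Fin 2) (Fin 2) ℂ) = lam • 1 := by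
      rw [Matrix.eta_fin_two ((z : GL (Fin 2) ℂ) : Matrix (Fin 2) (Fin 2) ℂ), h01, h10, h11]
      ext i j
      fin_cases i <;> fin_cases j <;> simp [hlam]
    refine ⟨lam, ?_, hz'⟩
    have hmem := (mem_U11_iff (z : GL (Fin 2) ℂ)).mp z.2
    rw [MemU11, hz', conjTranspose_smul, conjTranspose_one, smul_mul_assoc, Matrix.one_mul,
      mul_smul_comm, Matrix.mul_one, smul_smul, Complex.star_def, mul_comm,
      ← Complex.normSq_eq_conj_mul_self] at hmem
    have h00 := congr_fun (congr_fun hmem 0) 0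
    simp [J] at h00
    exact_mod_cast h00
  · rintro ⟨lam, hlam, hz⟩
    have hlam0 : lam ≠ 0 := by
      intro h0; rw [h0, map_zero] at hlam; exact zero_ne_one hlam
    have hzu : (z : GL (Fin 2) ℂ) = scalarUnit lam hlam0 := Units.ext (by rw [hz]; rfl)
    rw [Subgroup.mem_center_iff]
    intro x
    apply Subtype.ext
    show (x : GL (Fin 2) ℂ) * (z : GL (Fin 2) ℂ) = (z : GL (Fin 2) ℂ) * (x : GL (Fin 2) ℂ)
    rw [hzu]
    exact Subgroup.mem_center_iff.mp (scalarUnit_mem_center lam hlam0) (x : GL (Fin 2) ℂ)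

end Summit.Ventures.HodgeRepro2.T5U11Center
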